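import Summits.SmoothPoincare4.SmoothPoincare4.Theses.SullivanDual

/-!
# `HyperbolicEnd` (stmt-SmoothPoincare4-7825), negative side: the crux contains the open support
# item `AdmissibleJExists` (stmt-SmoothPoincare4-7830)

Line `Sketch`, lead cycle 3 (structural record). The first five conjuncts of the crux
`HyperbolicEnd` are, verbatim, the body of the route's support item `AdmissibleJExists`
("every punctured homotopy 4-sphere carries a smooth `J` with `J² = -1`, standard on a punctured
chart ball whose closure lies in the chart target"). Hence:

* `admissibleJExists_of_hyperbolicEnd` — `HyperbolicEnd → AdmissibleJExists` (projection);
* `not_hyperbolicEnd_of_not_admissibleJExists` — contrapositive: a refutation of the support item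
  (the planner's declared misstatement detector for the boundary model) refutes the crux;
* `admissibleJExists_of_punctureCertificate` — the open stub `stub_punctureCertificate` (K2) of
  line `Sketch` (its statement copied verbatim as the hypothesis) also contains `AdmissibleJExists`.

Consequence recorded for the planners (lead NOTES, `Cruxes/HyperbolicEnd/Lines/Sketch.dead.md`):
every closing file for the crux, along any line, must construct an admissible `J` on an ARBITRARY
`HomotopySphere 4`, i.e. prove `AdmissibleJExists`, which needs the triviality of the tangent
bundle of the punctured homotopy sphere compatibly with the inverted chart at the end (obstruction
theory; no statement of it is in the tree). Nothing here asserts a Theses statement.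
-/

noncomputable section

-- the prescribed namespace `Summit.<P>.<Sub>.…` duplicates `SmoothPoincare4` (P = Sub)
set_option linter.dupNamespace false

open scoped Manifold ContDiff Topology
open Laplacian Set Function
open Literature.Geometry.Symplectic Literature.Topology.FourManifolds
open Summit.SmoothPoincare4.SmoothPoincare4.Theses.SullivanDual

namespace Summit.SmoothPoincare4.SmoothPoincare4.Theorems.HyperbolicEnd.Negative

/-- **The crux contains the support item.** `HyperbolicEnd → AdmissibleJExists`: the admissible
almost complex structure asked for by `AdmissibleJExists` is the `J, ε'` of `HyperbolicEnd` with
its first five properties (projection of the existential). -/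
theorem admissibleJExists_of_hyperbolicEnd (h : HyperbolicEnd) : AdmissibleJExists := by
  intro S p
  obtain ⟨J, ε', hε', hball, hJ2, hJs, hJstd, -⟩ := h S p
  exact ⟨J, ε', hε', hball, hJ2, hJs, hJstd⟩

/-- **Contrapositive.** If some punctured homotopy `4`-sphere carries NO admissible `J` (a
refutation of the support item `AdmissibleJExists`, stmt-SmoothPoincare4-7830), then the crux
`HyperbolicEnd` is false. -/
theorem not_hyperbolicEnd_of_not_admissibleJExists (h : ¬ AdmissibleJExists) : ¬ HyperbolicEnd :=
  fun hH => h (admissibleJExists_of_hyperbolicEnd hH)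

/-- **The open stub K2 of line `Sketch` contains the support item.** The statement of
`Summit.SmoothPoincare4.SmoothPoincare4.Cruxes.HyperbolicEnd.Sketch.stub_punctureCertificate`
(copied verbatim as the hypothesis; `Cruxes/HyperbolicEnd/Lines/Sketch.lean`) implies
`AdmissibleJExists`: its `J, ε'` with the first five conjuncts. So the stub is at least as hard,
in the tree, as the open item stmt-SmoothPoincare4-7830. -/
theorem admissibleJExists_of_punctureCertificate
    (hP : ∀ (S : HomotopySphere 4) (p : S.carrier),
      ∃ (J : ∀ x : ↥(punctured p), TangentSpace (𝓡 4) x →L[ℝ] TangentSpace (𝓡 4) x) (ε' : ℝ)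
        (F : ∀ x : ↥(punctured p), TangentSpace (𝓡 4) x → ℝ) (c : ℝ) (q : S.carrier) (r₁ r₃ : ℝ),
        0 < ε' ∧ Metric.closedBall (extChartAt (𝓡 4) p p) ε' ⊆ (extChartAt (𝓡 4) p).target ∧
        (∀ (x : ↥(punctured p)) (v : TangentSpace (𝓡 4) x), J x (J x v) = -v) ∧
        (∀ x₀ : ↥(punctured p), ContMDiffAt (𝓡 4)
          𝓘(ℝ, EuclideanSpace ℝ (Fin 4) →L[ℝ] EuclideanSpace ℝ (Fin 4)) ∞
          (inTangentCoordinates (𝓡 4) (𝓡 4) (id : ↥(punctured p) → ↥(punctured p)) id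
            (fun x => J x) x₀) x₀) ∧
        (∀ x : ↥(punctured p), InPuncturedChartBall p ε' x →
          ∀ (v : TangentSpace (𝓡 4) x) (b : EuclideanSpace ℝ (Fin 4)),
            inner ℝ (fderiv ℝ inversion (extChartAt (𝓡 4) p x.1 - extChartAt (𝓡 4) p p)
              (mfderiv (𝓡 4) 𝓘(ℝ, EuclideanSpace ℝ (Fin 4))
                (fun z : ↥(punctured p) => extChartAt (𝓡 4) p z.1) x (J x v))) b =
            stdSymplecticForm (fderiv ℝ inversion (extChartAt (𝓡 4) p x.1 - extChartAt (𝓡 4) p p)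
              (mfderiv (𝓡 4) 𝓘(ℝ, EuclideanSpace ℝ (Fin 4))
                (fun z : ↥(punctured p) => extChartAt (𝓡 4) p z.1) x v)) b) ∧
        0 < c ∧ 0 < r₁ ∧ r₁ < r₃ ∧
        Metric.closedBall (extChartAt (𝓡 4) q q) r₃ ⊆ (extChartAt (𝓡 4) q).target ∧
        (∀ y ∈ Metric.closedBall (extChartAt (𝓡 4) q q) r₃, (extChartAt (𝓡 4) q).symm y ≠ p) ∧
        (∀ x : ↥(punctured p), x.1 ∈ (chartAt (EuclideanSpace ℝ (Fin 4)) q).source →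
          extChartAt (𝓡 4) q x.1 ∈ Metric.closedBall (extChartAt (𝓡 4) q q) r₃ →
          ¬ InPuncturedChartBall p ε' x) ∧
        ContMDiff (𝓡 4).tangent 𝓘(ℝ, ℝ) ∞
          (fun v : TangentBundle (𝓡 4) ↥(punctured p) => F v.proj v.snd) ∧
        (∀ (x : ↥(punctured p)) (v : TangentSpace (𝓡 4) x), 0 ≤ F x v ∧ (F x v = 0 → v = 0)) ∧
        (∀ (U : Set ℂ) (f : ℂ → ↥(punctured p)), IsOpen U →
          ContMDiffOn 𝓘(ℝ, ℂ) (𝓡 4) ∞ f U →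
          (∀ z ∈ U, ∀ ζ : ℂ, mfderiv 𝓘(ℝ, ℂ) (𝓡 4) f z (Complex.I * ζ : ℂ) =
            J (f z) (mfderiv 𝓘(ℝ, ℂ) (𝓡 4) f z (ζ : ℂ))) →
          (∀ z ∈ U, ¬ InPuncturedChartBall p ε' (f z)) →
          (∀ z ∈ U, (f z).1 ∈ (chartAt (EuclideanSpace ℝ (Fin 4)) q).source →
              extChartAt (𝓡 4) q (f z).1 ∉ Metric.closedBall (extChartAt (𝓡 4) q q) r₁) →
          ContDiffOn ℝ 2 (fun w => F (f w) (mfderiv 𝓘(ℝ, ℂ) (𝓡 4) f w (1 : ℂ))) U ∧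
          ∀ z ∈ U, 2 * c * (F (f z) (mfderiv 𝓘(ℝ, ℂ) (𝓡 4) f z (1 : ℂ))) ^ 3 ≤
            F (f z) (mfderiv 𝓘(ℝ, ℂ) (𝓡 4) f z (1 : ℂ)) *
                (Δ (fun w => F (f w) (mfderiv 𝓘(ℝ, ℂ) (𝓡 4) f w (1 : ℂ)))) z -
              ((fderiv ℝ (fun w => F (f w) (mfderiv 𝓘(ℝ, ℂ) (𝓡 4) f w (1 : ℂ))) z 1) ^ 2 +
                (fderiv ℝ (fun w => F (f w) (mfderiv 𝓘(ℝ, ℂ) (𝓡 4) f w (1 : ℂ))) z Complex.I) ^ 2))) :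
    AdmissibleJExists := by
  intro S p
  obtain ⟨J, ε', _F, _c, _q, _r₁, _r₃, hε', hball, hJ2, hJs, hJstd, -⟩ := hP S p
  exact ⟨J, ε', hε', hball, hJ2, hJs, hJstd⟩

end Summit.SmoothPoincare4.SmoothPoincare4.Theorems.HyperbolicEnd.Negative

end
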